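import Literature.AlgebraicGeometry.Deformation.ObstructionClassOfLift
import Literature.AlgebraicGeometry.Deformation.LiftOfVanishingClass
import Literature.AlgebraicGeometry.Deformation.AdaptedLifts
import Literature.AlgebraicGeometry.KTheory.PullbackVectorBundle
import HarnessLib

/-!
# The Čech obstruction class of a finite locally free module across a first-order thickening

Setting: `j : Y ⟶ Z₀` a closed immersion, `i : Z₀ ⟶ Z₁` a first-order thickening with `Z₁`
separated, `eI : i_* j_* 𝒪_Y ≅ 𝓘 = Ker(i♯)` (the "coefficient" isomorphism: the ideal of the
thickening is the structure sheaf of `Y`), and a finite locally free `𝒪_{Z₀}`-module `F` with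
`E = j^*F`.

* `exists_affine_frameCover` / `exists_affine_datum` — **a framed lifting datum exists**: frames of
  `F` over the preimages of AFFINE opens `U_z ∋ z` of `Z₁` (point-indexed; `i` is a surjective closed
  immersion) and lifts `T̃_{zw}` of the transition matrices over the affine `U_z ∩ U_w`
  (`liftsOfIsAffineOpen`);
* `cechObstructionClass hF eI : Ext²(E, E)` — **the obstruction class** `ob(F) = [toLocalFamily κ(c)]`,
  the Čech class (`Cech.classOf`, canonical exact augmentation) of the obstruction cocycle of a
  CHOSEN affine datum;
* `cechObstructionClass_eq_classOf` — it is the class of the obstruction cocycle of ANY datum by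
  affine opens whose base opens cover `Y` (`classOf_obstruction_eq`);
* `cechObstructionClass_eq_zero_iff` — **the lifting criterion**:
  `ob(F) = 0 ↔ ∃ F'` finite locally free on `Z₁` with `i^*F' ≅ F`
  (`exists_lift_of_classOf_eq_zero_pointIndexed` and `classOf_obstruction_eq_zero_of_iso_pullback`).

This is Hartshorne, *Deformation Theory*, Thm. 7.1 (obstruction to lifting a locally free sheaf
over a square-zero thickening, `H²(X₀, 𝓔nd ℱ₀ ⊗ 𝓘)`), with the class living in Mathlib's
`Ext²(j^*F, j^*F)` of `𝒪_Y`-modules. Everything is proved; no named facts.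

## References

* R. Hartshorne, *Deformation Theory*, GTM 257 (2010), §7, Thm. 7.1. [Hartshorne2010]
* L. Illusie, *Complexe cotangent et déformations I*, LNM 239 (1971), IV Prop. 3.1.5. [Illusie1971]
* The Stacks Project, Tag 08VR. [StacksProject]
-/

noncomputable section

open CategoryTheory CategoryTheory.Abelian AlgebraicGeometry Opposite TopologicalSpace Limits

namespace Literature.AlgebraicGeometry.Deformation

open Literature.AlgebraicGeometry.Modules Literature.AlgebraicGeometry.Motives

universe u

variable {Y Z₀ Z₁ : Scheme.{u}} {j : Y ⟶ Z₀} (i : Z₀ ⟶ Z₁) {F : Z₀.Modules}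

/-! ### Existence of an affine point-indexed datum -/

section Datum

variable [IsClosedImmersion i] [Surjective i]

/-- **Frames over preimages of affine opens `U_z ∋ z`**: a finite locally free `F` on `Z₀` has a
frame cover, indexed by the points of `Z₁`, by affine opens `U_z ∋ z` of `Z₁` (`i` a surjective
closed immersion, e.g. a first-order thickening). [cite: Hartshorne2010, §7 (proof of Thm. 7.1)] -/
theorem exists_affine_frameCover (hF : IsFiniteLocallyFree F) :
    ∃ C : FrameCover i F Z₁, (∀ z : Z₁, z ∈ C.U z) ∧ ∀ z : Z₁, IsAffineOpen (C.U z) := by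
  classical
  have key : ∀ z : Z₁, ∃ (x : Z₀) (U : Z₁.Opens), IsAffineOpen U ∧ z ∈ U ∧ i ⁻¹ᵁ U ≤ trivNbhd hF x :=
    fun z => by
      obtain ⟨x, hx⟩ := i.surjective z
      obtain ⟨U, hU, hxU, hle⟩ := exists_isAffineOpen_preimage_le i (mem_trivNbhd hF x)
      exact ⟨x, U, hU, hx ▸ hxU, hle⟩
  choose x U hU hz hle using key
  let C : FrameCover i F Z₁ :=
    { U := U
      I := fun z => TrivIndex hF (x z)
      e := fun z => SheafOfModules.restrictTrivialisation (R := Z₀.ringCatSheaf) (homOfLE (hle z))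
        (trivFrame hF (x z)) }
  exact ⟨C, hz, hU⟩

variable [Z₁.IsSeparated]

/-- **An affine point-indexed lifting datum exists** (`Z₁` separated: the `U_z ∩ U_w` are affine, so
the transition matrices lift). [cite: Hartshorne2010, §7 (proof of Thm. 7.1)] -/
theorem exists_affine_datum (hF : IsFiniteLocallyFree F) :
    ∃ (C : FrameCover i F Z₁) (_ : C.Lifts), (∀ z : Z₁, z ∈ C.U z) ∧ ∀ z : Z₁, IsAffineOpen (C.U z) := by
  obtain ⟨C, hz, hU⟩ := exists_affine_frameCover i hF
  exact ⟨C, C.liftsOfIsAffineOpen fun a b => (hU a).inf (hU b), hz, hU⟩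

end Datum

/-! ### The obstruction class -/

section Class

variable [IsFirstOrderThickening i] [Z₁.IsSeparated] (hF : IsFiniteLocallyFree F)

/-- The chosen affine point-indexed frame cover. [folklore] -/
def chosenCover : FrameCover i F Z₁ :=
  (exists_affine_datum i hF).choose

/-- The chosen lifts. [folklore] -/
def chosenLifts : (chosenCover i hF).Lifts :=
  (exists_affine_datum i hF).choose_spec.choose

/-- `z ∈ U_z` for the chosen cover. [folklore] -/
lemma mem_chosenCover_U (z : Z₁) : z ∈ (chosenCover i hF).U z :=
  (exists_affine_datum i hF).choose_spec.choose_spec.1 z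

/-- The opens of the chosen cover are affine. [folklore] -/
lemma isAffineOpen_chosenCover_U (z : Z₁) : IsAffineOpen ((chosenCover i hF).U z) :=
  (exists_affine_datum i hF).choose_spec.choose_spec.2 z

variable (j)

/-- The base opens of the chosen cover cover `Y`. [folklore] -/
lemma iSup_chosenCover_baseFraming_U : iSup ((chosenCover i hF).baseFraming j).U = ⊤ :=
  FrameCover.Lifts.iSup_baseFraming_U_eq_top_of_mem (mem_chosenCover_U i hF)

variable {i j}
  (eI : (Scheme.Modules.pushforward i).obj ((Scheme.Modules.pushforward j).obj (unitModule Y)) ≅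
    idealModule i)
  [HasExt.{u + 1} Y.Modules]

/-- **The Čech obstruction class `ob(F) ∈ Ext²(j^*F, j^*F)`** of a finite locally free `𝒪_{Z₀}`-module
across the first-order thickening `i`, with coefficients identified by `eI : i_* j_* 𝒪_Y ≅ 𝓘`:
the class of the obstruction cocycle of the chosen affine datum.
[cite: Hartshorne2010, §7, Thm. 7.1] [cite: Illusie1971, IV Prop. 3.1.5] -/
def cechObstructionClass :
    Ext ((Scheme.Modules.pullback j).obj F) ((Scheme.Modules.pullback j).obj F) 2 :=
  Cech.classOf (Cech.exactAugmentation ((chosenCover i hF).baseFraming j).U _ (iSup_chosenCover_baseFraming_U j i hF))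
    (((chosenCover i hF).baseFraming j).toLocalFamily ((chosenLifts i hF).defectCochain eI))
    (FrameCover.Lifts.dFamily_toLocalFamily_defectCochain eI _)

/-- **The obstruction class is computed by ANY affine datum** whose base opens cover `Y`.
[cite: Hartshorne2010, §7 (proof of Thm. 7.1)] -/
theorem cechObstructionClass_eq_classOf {ι : Type u} {C : FrameCover i F ι} (L : C.Lifts)
    (hUaff : ∀ a, IsAffineOpen (C.U a)) (hcovY : iSup (C.baseFraming j).U = ⊤)
    (hω : Cech.dFamily ((C.baseFraming j).toLocalFamily (L.defectCochain eI)) = 0) :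
    cechObstructionClass hF eI =
      Cech.classOf (Cech.exactAugmentation (C.baseFraming j).U _ hcovY)
        ((C.baseFraming j).toLocalFamily (L.defectCochain eI)) hω :=
  FrameCover.Lifts.classOf_obstruction_eq L (chosenLifts i hF) eI hcovY (iSup_chosenCover_baseFraming_U j i hF)
    (fun p => (hUaff p.1).inf (isAffineOpen_chosenCover_U i hF p.2)) hω _

variable [IsClosedImmersion j]

/-- **The lifting criterion** (Hartshorne, *Deformation Theory*, Thm. 7.1): `ob(F) = 0` iff `F` is
the restriction `i^*F'` of a finite locally free `𝒪_{Z₁}`-module `F'`.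
[cite: Hartshorne2010, §7, Thm. 7.1] -/
theorem cechObstructionClass_eq_zero_iff :
    cechObstructionClass hF eI = 0 ↔
      ∃ F' : Z₁.Modules, IsFiniteLocallyFree F' ∧ Nonempty ((Scheme.Modules.pullback i).obj F' ≅ F) := by
  constructor
  · intro h0
    exact (chosenLifts i hF).exists_lift_of_classOf_eq_zero_pointIndexed eI (isAffineOpen_chosenCover_U i hF)
      (mem_chosenCover_U i hF) (hF.pullback j) _ h0
  · rintro ⟨F', hF', ⟨φ⟩⟩
    exact (chosenLifts i hF).classOf_obstruction_eq_zero_of_iso_pullback eI (isAffineOpen_chosenCover_U i hF) _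
      hF' φ _

end Class

end Literature.AlgebraicGeometry.Deformation

end
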